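import Summits.ResolutionOfSingularities.KangarooAtlas.MizutaniLayer
import Mathlib.RingTheory.MvPolynomial.Homogeneous
import HarnessLib

/-!
# Mizutani's conjecture `m(e) = 2p^e − 1` — SPREADING, I: the elementary substitution and the recombined operators

Cell topic `Summits/ResolutionOfSingularities/KangarooAtlas` (pub-rosobs); namespace
`Summit.ResolutionOfSingularities.KangarooAtlas.Mizutani`.  Part of the Lean transcription of the
in-house note MIZUTANI-PROOF-g59 (AI-written, AI-audited; *AI review is weaker than expert review*; not a
resolution theorem).  Encloser-1 ARCH-e1 (S2): the abstract form of the note's §5 "GL_s acts and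
preserves profiles" (here: one elementary substitution at a time, over any coefficient ring / field).

* `theta j i β : X_j ↦ X_j + β X_i` (a `k`-algebra automorphism of `MvPolynomial ι k`; in a tower this is
  the change of `p`-basis `a_i ↦ a_i − β a_j`, under which `t = a ⊗ 1 − 1 ⊗ a` transforms linearly);
* `recombD j i β D` — the RECOMBINED operator family `D'_T = Σ_{|T₁| = |T|} coeff_T(θ X^{T₁}) · D_{T₁}`
  (the Hasse–Schmidt operators of the new `p`-basis); it is again additive with `D'_0 = id` and the same
  constants;
* generating functions `Dhat`, `Ehat` (`ℰ(f) = Σ_M 𝒟(κ_M) · (X+u)^M`, with the tree's `taylor`) and the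
  identity `thetaBig (Ehat D f) = Ehat D' (theta f)` (`thetaBig_Ehat`), whence the **KEY FORMULA**
  `opE_theta`: `E^{D'}_T (θ f) = Σ_{|T₁| = |T|} coeff_T(θ X^{T₁}) · θ (E^D_{T₁} f)`;
* `trunc q` — truncation to the box (the relations `t_i^q = 0` of `k ⊗_L k`), commuting with `E_T` for
  `T` in the box in characteristic `p` (part II), and the profile inequality
  `eProfile D' i (trunc (θ f)) ≤ eProfile D i f` (part II).

References: [Mizutani1973HironakaGroupSchemes] (Remark 2.10; in-house proof §5 AUTOMORPHISMS, Thm D″);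
[EGAIV4] Thm. 16.11.2.
-/

open MvPolynomial Literature.AlgebraicGeometry.Resolution

namespace Summit.ResolutionOfSingularities.KangarooAtlas.Mizutani

section Theta

variable {ι : Type*} [DecidableEq ι] {k : Type*} [CommRing k]

/-- **The elementary substitution** `θ = θ_{j,i,β}`: `X_j ↦ X_j + β X_i`, the other variables fixed
(MIZUTANI-PROOF-g59 §5: the linear change of the `p`-basis acting on `t`).
[cite: Mizutani1973HironakaGroupSchemes, Remark 2.10 (in-house proof §5, A ∈ GL_s acting by t ↦ At)] -/
noncomputable def theta (j i : ι) (β : k) : MvPolynomial ι k →ₐ[k] MvPolynomial ι k :=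
  aeval fun l => if l = j then X j + C β * X i else X l

/-- `θ` on a variable. [folklore] -/
theorem theta_X (j i : ι) (β : k) (l : ι) :
    theta j i β (X l) = if l = j then X j + C β * X i else X l := by
  unfold theta; rw [aeval_X]

/-- `θ` fixes constants. [folklore] -/
@[simp] theorem theta_C (j i : ι) (β : k) (c : k) : theta j i β (C c) = C c := by
  unfold theta; rw [aeval_C]; rfl

/-- The images of the variables under `θ` are linear forms. [folklore] -/
theorem isHomogeneous_theta_X (j i : ι) (β : k) (l : ι) : (theta j i β (X l)).IsHomogeneous 1 := by
  rw [theta_X]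
  split_ifs
  · exact (isHomogeneous_X k j).add (isHomogeneous_C_mul_X β i)
  · exact isHomogeneous_X k l

/-- `θ` maps monomials to homogeneous polynomials of the same degree. [folklore] -/
theorem isHomogeneous_theta_monomial (j i : ι) (β : k) (T : ι →₀ ℕ) (c : k) :
    (theta j i β (monomial T c)).IsHomogeneous T.degree := by
  have h := (isHomogeneous_monomial (d := T) c rfl).eval₂ (C : k →+* MvPolynomial ι k)
    (fun l => theta j i β (X l)) (fun r => isHomogeneous_C ι r) (isHomogeneous_theta_X j i β)
  rw [one_mul] at h
  have hev : eval₂ (C : k →+* MvPolynomial ι k) (fun l => theta j i β (X l)) (monomial T c) =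
      theta j i β (monomial T c) := by
    unfold theta
    rw [aeval_def]
    simp only [aeval_X]
    rfl
  rw [hev] at h
  exact h

/-- **Degree bookkeeping**: `coeff_T (θ X^{T₁}) ≠ 0 ⟹ |T| = |T₁|`. [folklore] -/
theorem degree_eq_of_coeff_theta_monomial_ne_zero (j i : ι) (β : k) {T T₁ : ι →₀ ℕ} (c : k)
    (h : coeff T (theta j i β (monomial T₁ c)) ≠ 0) : T.degree = T₁.degree := by
  by_contra hne
  exact h ((isHomogeneous_theta_monomial j i β T₁ c).coeff_eq_zero hne)

/-! ### The recombined operator family -/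

/-- The recombination coefficients `c_{T,T₁} = coeff_T (θ X^{T₁})`. [folklore] -/
noncomputable def thetaCoeff (j i : ι) (β : k) (T T₁ : ι →₀ ℕ) : k :=
  coeff T (theta j i β (monomial T₁ 1))

variable [Fintype ι]

/-- **The recombined operators** `D'_T = Σ_{|T₁| ≤ |T|} c_{T,T₁} D_{T₁}` (only `|T₁| = |T|` contributes):
the Hasse–Schmidt operators of the transformed `p`-basis (MIZUTANI-PROOF-g59 §5 / encloser-1 ARCH-e1 (S2)).
[cite: Mizutani1973HironakaGroupSchemes, Remark 2.10 (in-house proof §5, invariance under φ ⊗ φ)] -/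
noncomputable def recombD (j i : ι) (β : k) (D : (ι →₀ ℕ) → k →+ k) (T : ι →₀ ℕ) : k →+ k where
  toFun κ := ∑ T₁ ∈ degLE ι T.degree, thetaCoeff j i β T T₁ * D T₁ κ
  map_zero' := by simp
  map_add' a b := by
    rw [← Finset.sum_add_distrib]
    refine Finset.sum_congr rfl fun T₁ _ => ?_
    rw [map_add, mul_add]

/-- `recombD` applied. [folklore] -/
theorem recombD_apply (j i : ι) (β : k) (D : (ι →₀ ℕ) → k →+ k) (T : ι →₀ ℕ) (κ : k) :
    recombD j i β D T κ = ∑ T₁ ∈ degLE ι T.degree, thetaCoeff j i β T T₁ * D T₁ κ := rfl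

/-- `D'_0 = D_0` (so `D'_0 = id` when `D_0 = id`). [folklore] -/
theorem recombD_zero (j i : ι) (β : k) (D : (ι →₀ ℕ) → k →+ k) (hD0 : D 0 = AddMonoidHom.id k) :
    recombD j i β D 0 = AddMonoidHom.id k := by
  ext κ
  rw [recombD_apply, map_zero]
  have hdeg : degLE ι 0 = {0} := by
    ext T
    rw [mem_degLE, Finset.mem_singleton, Nat.le_zero, Finsupp.degree_eq_zero_iff]
  rw [hdeg, Finset.sum_singleton, hD0, thetaCoeff, monomial_zero', C_1, map_one, coeff_one, if_pos rfl,
    one_mul]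

/-- `recombD` keeps `L`-linearity of the operators for any set of scalars `L`. [folklore] -/
theorem recombD_mul (j i : ι) (β : k) (D : (ι →₀ ℕ) → k →+ k) {c : k}
    (hc : ∀ T x, D T (c * x) = c * D T x) (T : ι →₀ ℕ) (x : k) :
    recombD j i β D T (c * x) = c * recombD j i β D T x := by
  rw [recombD_apply, recombD_apply, Finset.mul_sum]
  exact Finset.sum_congr rfl fun T₁ _ => by rw [hc]; ring

end Theta

/-! ## Generating functions -/

section GenFun

variable {ι : Type*} [DecidableEq ι] [Fintype ι] {k : Type*} [CommRing k]

/-- The ring `k[X][u]` of the generating functions: outer variables `u`, inner variables `X`.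
[cite: EGAIV4, Thm. 16.11.2 (Taylor morphism)] -/
abbrev Big (ι k : Type*) [CommRing k] := MvPolynomial ι (MvPolynomial ι k)

/-- `𝒟_n(κ) = Σ_{|T| ≤ n} D_T(κ) u^T`. [cite: EGAIV4, Thm. 16.11.2 (16.11.2.2)] -/
noncomputable def Dhat (D : (ι →₀ ℕ) → k →+ k) (n : ℕ) (κ : k) : Big ι k :=
  ∑ T ∈ degLE ι n, monomial T (C (D T κ))

/-- `ℰ_n(f) = Σ_M 𝒟_n(κ_M) · (X + u)^M`. [cite: EGAIV4, Thm. 16.11.2] -/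
noncomputable def Ehat (D : (ι →₀ ℕ) → k →+ k) (n : ℕ) (f : MvPolynomial ι k) : Big ι k :=
  ∑ M ∈ f.support, Dhat D n (coeff M f) * taylor k (monomial M 1)

/-- `𝒟_n` is additive. [folklore] -/
theorem Dhat_add (D : (ι →₀ ℕ) → k →+ k) (n : ℕ) (a b : k) :
    Dhat D n (a + b) = Dhat D n a + Dhat D n b := by
  unfold Dhat
  rw [← Finset.sum_add_distrib]
  exact Finset.sum_congr rfl fun T _ => by rw [map_add, map_add, map_add]

/-- `𝒟_n(0) = 0`. [folklore] -/
@[simp] theorem Dhat_zero (D : (ι →₀ ℕ) → k →+ k) (n : ℕ) : Dhat D n (0 : k) = 0 := by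
  unfold Dhat
  exact Finset.sum_eq_zero fun T _ => by rw [map_zero, map_zero, map_zero]

/-- `𝒟_n` pulls out scalars the operators commute with. [folklore] -/
theorem Dhat_mul (D : (ι →₀ ℕ) → k →+ k) (n : ℕ) {c : k} (hc : ∀ T x, D T (c * x) = c * D T x)
    (x : k) : Dhat D n (c * x) = C (C c) * Dhat D n x := by
  unfold Dhat
  rw [Finset.mul_sum]
  exact Finset.sum_congr rfl fun T _ => by rw [hc, C_mul, C_mul_monomial]

/-- Outer coefficients of `𝒟_n`. [folklore] -/
theorem coeff_Dhat (D : (ι →₀ ℕ) → k →+ k) (n : ℕ) (κ : k) (T : ι →₀ ℕ) :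
    coeff T (Dhat D n κ) = if T.degree ≤ n then C (D T κ) else 0 := by
  unfold Dhat
  rw [coeff_sum]
  simp only [coeff_monomial]
  rw [Finset.sum_ite_eq']
  simp only [mem_degLE]

/-- The summand of `ℰ_n` as an additive map of the coefficient. [folklore] -/
noncomputable def EhatTerm (D : (ι →₀ ℕ) → k →+ k) (n : ℕ) (M : ι →₀ ℕ) : k →+ Big ι k where
  toFun κ := Dhat D n κ * taylor k (monomial M 1)
  map_zero' := by rw [Dhat_zero, zero_mul]
  map_add' a b := by rw [Dhat_add, add_mul]

/-- `ℰ_n` over any finite set containing the support. [folklore] -/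
theorem Ehat_eq_sum_subset (D : (ι →₀ ℕ) → k →+ k) (n : ℕ) (f : MvPolynomial ι k)
    {S : Finset (ι →₀ ℕ)} (hS : f.support ⊆ S) :
    Ehat D n f = ∑ M ∈ S, Dhat D n (coeff M f) * taylor k (monomial M 1) :=
  sum_support_subset (EhatTerm D n) f hS

/-- `ℰ_n` is additive. [folklore] -/
theorem Ehat_add (D : (ι →₀ ℕ) → k →+ k) (n : ℕ) (f g : MvPolynomial ι k) :
    Ehat D n (f + g) = Ehat D n f + Ehat D n g := by
  rw [Ehat_eq_sum_subset D n (f + g) (support_add (p := f) (q := g)),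
    Ehat_eq_sum_subset D n f (Finset.subset_union_left (s₂ := g.support)),
    Ehat_eq_sum_subset D n g (Finset.subset_union_right (s₁ := f.support)), ← Finset.sum_add_distrib]
  exact Finset.sum_congr rfl fun M _ => by rw [coeff_add, Dhat_add, add_mul]

/-- `ℰ_n` of a monomial. [folklore] -/
theorem Ehat_monomial (D : (ι →₀ ℕ) → k →+ k) (n : ℕ) (M : ι →₀ ℕ) (κ : k) :
    Ehat D n (monomial M κ) = Dhat D n κ * taylor k (monomial M 1) := by
  rw [Ehat_eq_sum_subset D n _ (support_monomial_subset (s := M) (a := κ)), Finset.sum_singleton,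
    coeff_monomial, if_pos rfl]

/-- **(G1) Reading off `E_T`**: for `|T| ≤ n`, the coefficient of `u^T` in `ℰ_n(f)` is `E_T f`
(the tree's `hasseDeriv_monomial` supplies the multivariate binomial expansion of `(X+u)^M`).
[cite: EGAIV4, Thm. 16.11.2 (16.11.2.1)–(16.11.2.2)] -/
theorem coeff_Ehat (D : (ι →₀ ℕ) → k →+ k) {n : ℕ} (f : MvPolynomial ι k) {T : ι →₀ ℕ}
    (hT : T.degree ≤ n) : coeff T (Ehat D n f) = opE D T f := by
  rw [Ehat, coeff_sum, opE_eq_sum]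
  refine Finset.sum_congr rfl fun M _ => ?_
  rw [coeff_mul]
  show _ = ∑ x ∈ Finset.antidiagonal T, monomial (M - x.2) ((mchoose M x.2 : k) * D x.1 (coeff M f))
  refine Finset.sum_congr rfl fun x hx => ?_
  have hx1 : x.1.degree ≤ n := by
    rw [Finset.mem_antidiagonal] at hx
    have := map_add Finsupp.degree x.1 x.2  -- degree is additive
    rw [hx] at this
    omega
  rw [coeff_Dhat, if_pos hx1, ← hasseDeriv_apply, hasseDeriv_monomial]
  have hcast : ((∏ l ∈ x.2.support, (M l).choose (x.2 l) : ℕ) : MvPolynomial ι k) =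
      C ((mchoose M x.2 : ℕ) : k) := (map_natCast C _).symm
  rw [hcast, ← mul_assoc, ← C_mul, C_mul_monomial, mul_one, mul_comm]

/-! ### The substitution on the generating functions -/

/-- `θ̃`: the substitution `X ↦ θX` on the inner variables and `u ↦ θu` on the outer variables of
`k[X][u]`. [cite: Mizutani1973HironakaGroupSchemes, Remark 2.10 (in-house proof §5, φ ⊗ φ)] -/
noncomputable def thetaBig (j i : ι) (β : k) : Big ι k →+* Big ι k :=
  (aeval (R := MvPolynomial ι k) fun l =>
      if l = j then (X j : Big ι k) + C (C β) * X i else X l).toRingHom.comp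
    (MvPolynomial.map (theta j i β).toRingHom)

omit [Fintype ι] in
/-- `θ̃` on inner coefficients. [folklore] -/
@[simp] theorem thetaBig_C (j i : ι) (β : k) (f : MvPolynomial ι k) :
    thetaBig j i β (C f) = C (theta j i β f) := by
  simp [thetaBig]

omit [Fintype ι] in
/-- `θ̃` on outer variables. [folklore] -/
theorem thetaBig_X (j i : ι) (β : k) (l : ι) :
    thetaBig j i β (X l) = if l = j then (X j : Big ι k) + C (C β) * X i else X l := by
  simp [thetaBig]

omit [Fintype ι] in
/-- The outer substitution pattern is the inner one lifted: `θ̃ (u^T) = (θ X^T)(u)`. [folklore] -/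
theorem thetaBig_monomial_one (j i : ι) (β : k) (T : ι →₀ ℕ) :
    thetaBig j i β (monomial T 1) = MvPolynomial.map C (theta j i β (monomial T 1)) := by
  -- both sides are ring maps `MvPolynomial ι k → Big ι k` applied to `monomial T 1`
  have key : ((thetaBig j i β).comp (MvPolynomial.map (C : k →+* MvPolynomial ι k))) =
      (MvPolynomial.map (C : k →+* MvPolynomial ι k)).comp (theta j i β).toRingHom := by
    refine MvPolynomial.ringHom_ext (fun c => ?_) (fun l => ?_)
    · simp [thetaBig]
    · rw [RingHom.comp_apply, RingHom.comp_apply, map_X, thetaBig_X]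
      show _ = MvPolynomial.map C (theta j i β (X l))
      rw [theta_X]
      split_ifs <;> simp
  have h := RingHom.congr_fun key (monomial T 1)
  rw [RingHom.comp_apply, RingHom.comp_apply, map_monomial, map_one] at h
  exact h

omit [Fintype ι] in
/-- **`θ̃ ∘ Tay = Tay ∘ θ`**. [cite: EGAIV4, Thm. 16.11.2 (functoriality of the Taylor morphism)] -/
theorem thetaBig_taylor (j i : ι) (β : k) (f : MvPolynomial ι k) :
    thetaBig j i β (taylor k f) = taylor k (theta j i β f) := by
  have key : (thetaBig j i β).comp (taylor k (σ := ι)).toRingHom =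
      (taylor k (σ := ι)).toRingHom.comp (theta j i β).toRingHom := by
    refine MvPolynomial.ringHom_ext (fun c => ?_) (fun l => ?_)
    · simp [thetaBig]
    · rw [RingHom.comp_apply, RingHom.comp_apply]
      show thetaBig j i β (taylor k (X l)) = taylor k (theta j i β (X l))
      rw [taylor_X, map_add, thetaBig_C, thetaBig_X, theta_X]
      split_ifs with h
      · subst h
        simp only [map_add, map_mul, taylor_X, taylor_C]
        ring
      · rw [taylor_X]
  exact RingHom.congr_fun key f

omit [Fintype ι] in
/-- Outer coefficients of `θ̃ F`: `coeff_T (θ̃ F) = Σ_{T₁} c_{T,T₁} · θ(coeff_{T₁} F)`. [folklore] -/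
theorem coeff_thetaBig (j i : ι) (β : k) (F : Big ι k) (T : ι →₀ ℕ) :
    coeff T (thetaBig j i β F) = ∑ T₁ ∈ F.support, C (thetaCoeff j i β T T₁) * theta j i β (coeff T₁ F) := by
  conv_lhs => rw [F.as_sum, map_sum, coeff_sum]
  refine Finset.sum_congr rfl fun T₁ _ => ?_
  rw [← mul_one (coeff T₁ F), ← C_mul_monomial, map_mul, thetaBig_C, thetaBig_monomial_one, coeff_C_mul,
    coeff_map, mul_one, mul_comm]
  rfl

/-- **`θ̃ 𝒟_n = 𝒟'_n`**: the substitution on `u` recombines the operators. [cite: Mizutani1973HironakaGroupSchemes, Remark 2.10 (in-house proof §5)] -/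
theorem thetaBig_Dhat (j i : ι) (β : k) (D : (ι →₀ ℕ) → k →+ k) (n : ℕ) (κ : k) :
    thetaBig j i β (Dhat D n κ) = Dhat (recombD j i β D) n κ := by
  refine MvPolynomial.ext _ _ fun T => ?_
  have hc0 : ∀ T₁ : ι →₀ ℕ, T₁.degree ≠ T.degree → thetaCoeff j i β T T₁ = 0 := fun T₁ h => by
    by_contra hne
    exact h (degree_eq_of_coeff_theta_monomial_ne_zero j i β 1 hne).symm
  have hL : coeff T (thetaBig j i β (Dhat D n κ)) =
      C (∑ T₁ ∈ degLE ι n, thetaCoeff j i β T T₁ * D T₁ κ) := by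
    unfold Dhat
    rw [map_sum, coeff_sum, map_sum]
    refine Finset.sum_congr rfl fun T₁ _ => ?_
    rw [← mul_one (C (D T₁ κ) : MvPolynomial ι k), ← C_mul_monomial, map_mul, thetaBig_C, theta_C,
      thetaBig_monomial_one, coeff_C_mul, coeff_map, C_mul, mul_comm]
    rfl
  rw [hL, coeff_Dhat]
  split_ifs with hT
  · rw [recombD_apply]
    congr 1
    symm
    apply Finset.sum_subset
    · intro T₁ hT₁
      exact mem_degLE.mpr ((mem_degLE.mp hT₁).trans hT)
    · intro T₁ _ hT₁
      rw [hc0 T₁ (fun h => hT₁ (mem_degLE.mpr h.le)), zero_mul]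
  · rw [Finset.sum_eq_zero, C_0]
    intro T₁ hT₁
    rw [hc0 T₁ (fun h => hT (h ▸ mem_degLE.mp hT₁)), zero_mul]

/-- **(G2)** `θ̃ (ℰ^D_n f) = ℰ^{D'}_n (θ f)` — provided the operators commute with the coefficients of
the substitution: here `L` is a subring of scalars containing `β` on which every `D_T` is linear.
[cite: Mizutani1973HironakaGroupSchemes, Remark 2.10 (in-house proof §5, φ Diff φ⁻¹ = Diff)] -/
theorem thetaBig_Ehat (j i : ι) {β : k} (L : Subring k) (hβ : β ∈ L) (D : (ι →₀ ℕ) → k →+ k)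
    (hDL : ∀ c ∈ L, ∀ T x, D T (c * x) = c * D T x) (n : ℕ) (f : MvPolynomial ι k) :
    thetaBig j i β (Ehat D n f) = Ehat (recombD j i β D) n (theta j i β f) := by
  -- the coefficients of `θ (monomial M 1)` lie in `L`
  have hcoefL : ∀ (M N : ι →₀ ℕ), coeff N (theta j i β (monomial M 1)) ∈ L := by
    intro M N
    -- `θ X^M` is the image of a polynomial with coefficients in `L`
    have hrange : theta j i β (monomial M 1) ∈ (MvPolynomial.map L.subtype).range := by
      rw [monomial_eq, C_1, one_mul, map_finsuppProd, Finsupp.prod]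
      refine prod_mem fun l _ => ?_
      rw [map_pow]
      refine pow_mem ?_ _
      rw [theta_X]
      split_ifs
      · refine ⟨X j + C ⟨β, hβ⟩ * X i, ?_⟩
        simp
      · exact ⟨X l, by simp⟩
    obtain ⟨g, hg⟩ := hrange
    rw [← hg, coeff_map]
    exact (coeff N g).2
  have hD'L : ∀ c ∈ L, ∀ T x, recombD j i β D T (c * x) = c * recombD j i β D T x :=
    fun c hc T x => recombD_mul j i β D (hDL c hc) T x
  induction f using MvPolynomial.induction_on' with
  | monomial M κ =>
    rw [Ehat_monomial, map_mul, thetaBig_Dhat, thetaBig_taylor]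
    set h := theta j i β (monomial M 1) with hh
    have hθ : theta j i β (monomial M κ) = C κ * h := by
      rw [hh, ← mul_one κ, ← C_mul_monomial, map_mul, theta_C, mul_one]
    have hsupp : (C κ * h).support ⊆ h.support := by
      rw [C_mul']; exact support_smul
    rw [hθ, Ehat_eq_sum_subset _ n _ hsupp]
    have hterm : ∀ N ∈ h.support,
        Dhat (recombD j i β D) n (coeff N (C κ * h)) * taylor k (monomial N 1) =
          Dhat (recombD j i β D) n κ * taylor k (monomial N (coeff N h)) := by
      intro N _
      have ht : taylor k (monomial N (coeff N h)) = C (C (coeff N h)) * taylor k (monomial N 1) := by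
        rw [← mul_one (coeff N h), ← C_mul_monomial, map_mul, taylor_C, mul_one]
      rw [coeff_C_mul, mul_comm κ, Dhat_mul _ n (hD'L _ (hcoefL M N)), ht, mul_assoc, mul_left_comm]
    rw [Finset.sum_congr rfl hterm, ← Finset.mul_sum, ← map_sum]
    congr 2
    exact h.as_sum
  | add f g hf hg => rw [Ehat_add, map_add, hf, hg, map_add, Ehat_add]

/-- **KEY FORMULA** (encloser-1 ARCH-e1 (S2)): `E^{D'}_T (θ f) = Σ_{|T₁| = |T|} c_{T,T₁} · θ (E^D_{T₁} f)`
(sum over `T₁ ∈ degLE |T|`; the terms with `|T₁| < |T|` vanish) — the profile operators of the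
substituted element are substituted combinations of profile operators of the same order.
[cite: Mizutani1973HironakaGroupSchemes, Remark 2.10 (in-house proof §1.4 INVARIANCES / §5)] -/
theorem opE_theta (j i : ι) {β : k} (L : Subring k) (hβ : β ∈ L) (D : (ι →₀ ℕ) → k →+ k)
    (hDL : ∀ c ∈ L, ∀ T x, D T (c * x) = c * D T x) (T : ι →₀ ℕ) (f : MvPolynomial ι k) :
    opE (recombD j i β D) T (theta j i β f) =
      ∑ T₁ ∈ degLE ι T.degree, C (thetaCoeff j i β T T₁) * theta j i β (opE D T₁ f) := by
  have hc0 : ∀ T₁ : ι →₀ ℕ, T₁.degree ≠ T.degree → thetaCoeff j i β T T₁ = 0 := fun T₁ h => by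
    by_contra hne
    exact h (degree_eq_of_coeff_theta_monomial_ne_zero j i β 1 hne).symm
  rw [← coeff_Ehat (recombD j i β D) (n := T.degree) _ le_rfl, ← thetaBig_Ehat j i L hβ D hDL,
    coeff_thetaBig]
  -- both sums carry the same non-zero terms: `T₁` of degree `|T|` in the support of `ℰ f`
  set F := Ehat D T.degree f with hF
  classical
  rw [Finset.sum_subset (Finset.subset_union_left (s₂ := degLE ι T.degree))
      (fun T₁ _ hT₁ => by rw [notMem_support_iff.mp hT₁, map_zero, mul_zero]),
    Finset.sum_subset (Finset.subset_union_right (s₁ := F.support)) (f := fun T₁ =>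
      C (thetaCoeff j i β T T₁) * theta j i β (opE D T₁ f))
      (fun T₁ _ hT₁ => by rw [hc0 T₁ (fun h => hT₁ (mem_degLE.mpr h.le)), C_0, zero_mul])]
  refine Finset.sum_congr rfl fun T₁ _ => ?_
  by_cases hT₁ : T₁.degree ≤ T.degree
  · rw [hF, coeff_Ehat D f hT₁]
  · rw [hc0 T₁ (fun h => hT₁ h.le), C_0, zero_mul, zero_mul]

end GenFun

end Summit.ResolutionOfSingularities.KangarooAtlas.Mizutani
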